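import Mathlib
import HarnessLib.Audit
import Summits.PneNP.PneNP.Theorems.PstarCrossCorner
import Summits.PneNP.PneNP.Theorems.PstarGateCasePUnitsTouch

/-!
# The blind free CROSS gate: a corner-constant second constraint does not READ a switchable private tree edge (O2 / E1; prover-1 g22)

FRONTIER range-avoidance ladder, rung F-N3 (`stmt-PneNP-19007`), cell `pnp-ideate`; restricted-model proof complexity — nothing here bears on `P` versus `NP`.

Cross data `B`; `q_{(1,0)} = F₂ + t₂` (`PstarChordBridgeBasis.qDir I B (1,0)`, polar form `polarDir I B (1,0)`, `PstarChordBridgeCorner.qDir_add`) is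
assumed CONSTANT on the corner `{u_p = u_q = 0}` (regime P: `PstarCrossCaseP.orU_of_q`).  A SWITCHING SET is a set `S` of private tree edges whose
indicator point lies in the corner (`Switch`: `γ_p + #(D_p ∩ S) = 0 = γ_q + #(D_q ∩ S)`).  For a private tree edge `π` with AND variable `v = vars π s`:

* `polarDir10_zero` — if some switching set avoids `π` and the variable `w ∉ {v, v'}`, then `polarDir_{(1,0)}(e_w, e_v) = 0` (`PstarCrossCorner.corner_square`);
* `qDir10_single` — if some switching set `S₀ ∌ π` exists all of whose AND variables `u` admit switching sets avoiding `π` and `u`, then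
  `q_{(1,0)}(e_v) = q_{(1,0)}(0)` (`corner_pair` + linearity);
* **`not_mem_C₂`** — then `v ∉ C₂`: the second constraint does not read `v` linearly (`PstarGateCasePUnitsTouch.not_mem_C_of_qDir`);
* `avoid_of_polar_zero_off_mate`, **`G₂_avoid`** — if every `w ∉ {v, v'}` admits a switching set avoiding `π` and `w`, then no monomial of the second
  constraint contains `v` (the polar form at `(e_w, e_v)` would be `1` for the gate's partner `w`; the mate `v'` is excluded by simple overlaps).
Which private edges are switchable is pure bookkeeping of the Venn classes of `(D_p, D_q)` among the private edges and of the levels `γ_p, γ_q` — the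
node files do it; the failures are exactly the planner's pinned classes (memo §14.42).
-/

set_option linter.dupNamespace false -- `Summit.PneNP.PneNP.…`: summit = sub-problem name (D-0017 single-conjunct layout)

open Finset Literature.Computability.Complexity
open Summit.PneNP.PneNP.Theorems.PstarFibrePolys (bit)
open Summit.PneNP.PneNP.Theorems.PstarTyped (Typed)
open Summit.PneNP.PneNP.Theorems.PstarSALevel (varSet SimpleOverlap)
open Summit.PneNP.PneNP.Theorems.PstarCentreFree (vars_mem_varSet)
open Summit.PneNP.PneNP.Theorems.PstarProductRank (qform polar)
open Summit.PneNP.PneNP.Theorems.PstarPathRank (AndAdj andPair_ne polar_basis)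
open Summit.PneNP.PneNP.Theorems.PstarReadSumset (V2)
open Summit.PneNP.PneNP.Theorems.PstarChordSystem (ChordSystem)
open Summit.PneNP.PneNP.Theorems.PstarChordBridgeTools
open Summit.PneNP.PneNP.Theorems.PstarChordBridge
open Summit.PneNP.PneNP.Theorems.PstarChordBridgeForcing (freeMon freePolar gam)
open Summit.PneNP.PneNP.Theorems.PstarChordBridgeBasis (qDir polarDir)
open Summit.PneNP.PneNP.Theorems.PstarChordBridgeCorner (qDir_add)
open Summit.PneNP.PneNP.Theorems.PstarGateCasePUnitsTouch (not_mem_C_of_qDir polarDir_single)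
open Summit.PneNP.PneNP.Theorems.PstarCrossData (CrossData)
open Summit.PneNP.PneNP.Theorems.PstarCrossCorner

namespace Summit.PneNP.PneNP.Theorems.PstarCrossCornerReads

variable {n m : ℕ}

section

variable (I : LocalMap 4 n m) {r : ℕ} {B : BridgeData n m} {e_p e_q g₀ : Fin m}

/-- A SWITCHING SET: private tree edges whose indicator point lies in the corner `{u_p = u_q = 0}`. -/
def Switch (I : LocalMap 4 n m) (B : BridgeData n m) (e_p e_q : Fin m) (S : Finset (Fin m)) : Prop :=
  (∀ j ∈ S, PrivEdge I B j) ∧ gam B e_p + (((B.D e_p).filter fun k => k ∈ S).card : ZMod 2) = 0 ∧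
    gam B e_q + (((B.D e_q).filter fun k => k ∈ S).card : ZMod 2) = 0

/-- The indicator point is the sum of the basis vectors of its support. -/
theorem ind_eq_sum (W : Finset (Fin n)) : ind W = ∑ u ∈ W, (Pi.single u (1 : ZMod 2) : Fin n → ZMod 2) := by
  classical
  funext v
  unfold ind
  rw [Finset.sum_apply]
  simp only [Pi.single_apply]
  rw [Finset.sum_ite_eq]

/-- An AND variable of a switching-set edge is not an AND variable of another private edge. -/
theorem ne_of_mem_privs {S : Finset (Fin m)} (hS : ∀ j ∈ S, PrivEdge I B j) {π : Fin m} (hπ : PrivEdge I B π) (hπS : π ∉ S)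
    {u : Fin n} (hu : u ∈ privs I S) {s : Fin 4} (hs : s = 2 ∨ s = 3) : u ≠ I.vars π s := by
  intro h
  obtain ⟨j, hj, hjv⟩ := (mem_privs I).1 hu
  have hne : j ≠ π := fun h' => hπS (h' ▸ hj)
  have hk := hπ.2 j (mem_sdiff.1 (hS j hj).1).1 hne
  have : I.vars π s ∉ varSet I j := by rcases hs with rfl | rfl; exacts [hk.1, hk.2]
  rcases hjv with h' | h'
  · exact this (h ▸ h' ▸ vars_mem_varSet I j 2)
  · exact this (h ▸ h' ▸ vars_mem_varSet I j 3)

/-- **The polar form of `q_{(1,0)}` vanishes at `(e_w, e_v)`** for `v` an AND variable of the private edge `π`, `w ∉ {v, v'}`, whenever some switching set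
avoids `π` and `w`. -/
theorem polarDir10_zero (hI : I.IsPure xorAndPred) (hD : CrossData I r B e_p e_q g₀) {κ : ZMod 2}
    (hK : ∀ a, (sys I B).u e_p a = 0 → (sys I B).u e_q a = 0 → qDir I B (1, 0) a = κ)
    {π : Fin m} (hπ : PrivEdge I B π) {s : Fin 4} (hs : s = 2 ∨ s = 3) {w : Fin n} (hwv : w ≠ I.vars π 2) (hwv' : w ≠ I.vars π 3)
    {S : Finset (Fin m)} (hS : Switch I B e_p e_q S) (hπS : π ∉ S) (hwS : w ∉ privs I S) :
    polarDir I B (1, 0) (Pi.single w 1) (Pi.single (I.vars π s) 1) = 0 :=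
  corner_square I hI hD (qDir_add I B (1, 0)) hK hS.1 hS.2.1 hS.2.2 hπ hπS hs hwv hwv' hwS

/-- **No linear term**: `q_{(1,0)}(e_v) = q_{(1,0)}(0)` when a switching set `S₀ ∌ π` exists all of whose AND variables admit switching sets avoiding
`π` and themselves. -/
theorem qDir10_single (hI : I.IsPure xorAndPred) (hD : CrossData I r B e_p e_q g₀) {κ : ZMod 2}
    (hK : ∀ a, (sys I B).u e_p a = 0 → (sys I B).u e_q a = 0 → qDir I B (1, 0) a = κ)
    {π : Fin m} (hπ : PrivEdge I B π) {s : Fin 4} (hs : s = 2 ∨ s = 3)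
    {S₀ : Finset (Fin m)} (hS₀ : Switch I B e_p e_q S₀) (hπS₀ : π ∉ S₀)
    (hsq : ∀ u ∈ privs I S₀, ∃ S, Switch I B e_p e_q S ∧ π ∉ S ∧ u ∉ privs I S) :
    qDir I B (1, 0) (Pi.single (I.vars π s) 1) = qDir I B (1, 0) 0 := by
  classical
  have h := corner_pair I hI hD (qDir_add I B (1, 0)) hK hS₀.1 hS₀.2.1 hS₀.2.2 hπ hπS₀ hs
  rw [ind_eq_sum, map_sum, LinearMap.sum_apply] at h
  rw [sum_eq_zero] at h
  · have e0 : ∀ a b : ZMod 2, a + b = 0 → a = b := by decide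
    exact e0 _ _ h
  · intro u hu
    obtain ⟨S, hS, hπS, huS⟩ := hsq u hu
    exact polarDir10_zero I hI hD hK hπ hs (ne_of_mem_privs I hS₀.1 hπ hπS₀ hu (Or.inl rfl)) (ne_of_mem_privs I hS₀.1 hπ hπS₀ hu (Or.inr rfl))
      hS hπS huS

/-- **The second constraint does not read `v` linearly.** -/
theorem not_mem_C₂ (hI : I.IsPure xorAndPred) (hT : Typed I) (hD : CrossData I r B e_p e_q g₀) {κ : ZMod 2}
    (hK : ∀ a, (sys I B).u e_p a = 0 → (sys I B).u e_q a = 0 → qDir I B (1, 0) a = κ)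
    {π : Fin m} (hπ : PrivEdge I B π) {s : Fin 4} (hs : s = 2 ∨ s = 3)
    {S₀ : Finset (Fin m)} (hS₀ : Switch I B e_p e_q S₀) (hπS₀ : π ∉ S₀)
    (hsq : ∀ u ∈ privs I S₀, ∃ S, Switch I B e_p e_q S ∧ π ∉ S ∧ u ∉ privs I S) : I.vars π s ∉ B.C₂ :=
  (not_mem_C_of_qDir I hI hT hD.wf hπ.1 (by rcases hs with rfl | rfl <;> decide)).2 (qDir10_single I hI hD hK hπ hs hS₀ hπS₀ hsq)

/-- **No private-free monomial on `v`, from vanishing polars off the mate.**  `π` a private tree edge with AND variable `v = vars π s` and mate `v'`,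
`T ⊆ J₀`, `G` off `J₀`: if `(polar T + polar (freeMon G))(e_w, e_v) = 0` for every `w ∉ {v, v'}`, then no monomial of `freeMon G` contains `v`. -/
theorem avoid_of_polar_zero_off_mate (hI : I.IsPure xorAndPred) (hS : SimpleOverlap I) {T G : Finset (Fin m)} (hTJ : T ⊆ B.J₀)
    (hGJ : Disjoint G B.J₀) {π : Fin m} (hπ : PrivEdge I B π) {s : Fin 4} (hs : s = 2 ∨ s = 3)
    (h : ∀ w, w ≠ I.vars π 2 → w ≠ I.vars π 3 →
      ((polar T (fun j => I.vars j 2) (fun j => I.vars j 3) + polar (freeMon I B.N G) (fun j => I.vars j 2) (fun j => I.vars j 3) :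
        LinearMap.BilinForm (ZMod 2) (Fin n → ZMod 2)) (Pi.single w 1)) (Pi.single (I.vars π s) 1) = 0) :
    ∀ g ∈ freeMon I B.N G, I.vars g 2 ≠ I.vars π s ∧ I.vars g 3 ≠ I.vars π s := by
  classical
  intro g hg
  have hgG : g ∈ G := (mem_filter.1 hg).1
  have hπJ : π ∈ B.J₀ := (mem_sdiff.1 hπ.1).1
  have hgπ : g ≠ π := fun h' => Finset.disjoint_left.1 hGJ hgG (h' ▸ hπJ)
  set v := I.vars π s with hv
  -- the partner `w` of `v` in `g` is neither `v` nor the mate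
  have key : ∀ w : Fin n, ((I.vars g 2 = w ∧ I.vars g 3 = v) ∨ (I.vars g 2 = v ∧ I.vars g 3 = w)) → False := by
    intro w hw
    have hwv : w ≠ v := by
      rcases hw with ⟨h2, h3⟩ | ⟨h2, h3⟩
      · rw [← h2, ← h3]; exact fun h' => absurd (hI.2 g h') (by decide)
      · rw [← h2, ← h3]; exact fun h' => absurd (hI.2 g h'.symm) (by decide)
    -- `w` is not the mate: else `g` and `π` share two variables
    have hw2 : w ≠ I.vars π 2 ∧ w ≠ I.vars π 3 := by
      constructor
      · intro hw2
        rcases hs with rfl | rfl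
        · exact hwv hw2
        · refine andPair_ne I hI hS hgπ ?_
          rcases hw with ⟨h2, h3⟩ | ⟨h2, h3⟩
          · exact Or.inl ⟨h2.trans hw2, h3⟩
          · exact Or.inr ⟨h2, h3.trans hw2⟩
      · intro hw3
        rcases hs with rfl | rfl
        · refine andPair_ne I hI hS hgπ ?_
          rcases hw with ⟨h2, h3⟩ | ⟨h2, h3⟩
          · exact Or.inr ⟨h2.trans hw3, h3⟩
          · exact Or.inl ⟨h2, h3.trans hw3⟩
        · exact hwv hw3
    have hT0 : ¬ AndAdj I T w v := by
      rintro ⟨j, hj, hjw⟩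
      -- `j ∈ T ⊆ J₀` contains `v`: it is `π`, whose pair is `{v, v'} ∌ w`
      have hjπ : j = π := by
        by_contra hne
        have hk := hπ.2 j (hTJ hj) hne
        have : v ∉ varSet I j := by rcases hs with rfl | rfl; exacts [hk.1, hk.2]
        rcases hjw with ⟨-, h3⟩ | ⟨h2, -⟩
        · exact this (h3 ▸ vars_mem_varSet I j 3)
        · exact this (h2 ▸ vars_mem_varSet I j 2)
      subst hjπ
      rcases hjw with ⟨h2, h3⟩ | ⟨h2, h3⟩
      · exact hw2.1 h2.symm
      · exact hw2.2 h3.symm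
    have hG1 : AndAdj I (freeMon I B.N G) w v := ⟨g, hg, hw⟩
    have := h w hw2.1 hw2.2
    rw [LinearMap.add_apply, LinearMap.add_apply, polar_basis I hI hS, polar_basis I hI hS, if_neg hT0, if_pos hG1, zero_add] at this
    exact one_ne_zero this
  exact ⟨fun h2 => key (I.vars g 3) (Or.inr ⟨h2, rfl⟩), fun h3 => key (I.vars g 2) (Or.inl ⟨rfl, h3⟩)⟩

/-- **No monomial of the second constraint contains `v`** when every `w ∉ {v, v'}` admits a switching set avoiding `π` and `w`. -/
theorem G₂_avoid (hI : I.IsPure xorAndPred) (hS : SimpleOverlap I) (hD : CrossData I r B e_p e_q g₀) {κ : ZMod 2}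
    (hK : ∀ a, (sys I B).u e_p a = 0 → (sys I B).u e_q a = 0 → qDir I B (1, 0) a = κ)
    {π : Fin m} (hπ : PrivEdge I B π) {s : Fin 4} (hs : s = 2 ∨ s = 3)
    (hsq : ∀ w, w ≠ I.vars π 2 → w ≠ I.vars π 3 → ∃ S, Switch I B e_p e_q S ∧ π ∉ S ∧ w ∉ privs I S) :
    ∀ g ∈ B.G₂, I.vars g 2 ≠ I.vars π s ∧ I.vars g 3 ≠ I.vars π s := by
  intro g hg
  -- every monomial of the second constraint is private-free (hun-cleanness)
  have hgf : g ∈ freeMon I B.N B.G₂ := by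
    refine mem_filter.2 ⟨hg, ?_⟩
    rintro (h2 | h3)
    · exact ((hD.hun _ h2).2 g hg).1 rfl
    · exact ((hD.hun _ h3).2 g hg).2 rfl
  refine avoid_of_polar_zero_off_mate I hI hS (hD.wf.hT₂.trans sdiff_subset) hD.disj₂ hπ hs (fun w hw2 hw3 => ?_) g hgf
  obtain ⟨S, hSw, hπS, hwS⟩ := hsq w hw2 hw3
  have h := polarDir10_zero I hI hD hK hπ hs hw2 hw3 hSw hπS hwS
  rw [polarDir_single] at h
  simpa using h

end

end Summit.PneNP.PneNP.Theorems.PstarCrossCornerReads
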